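import Summits.Ventures.PercRepro.C041TriDomGlueMerge
import Summits.Ventures.PercRepro.C041TriDomDominationSeparable

/-!
# ROW C-041 — GLUING AT A CUT VERTEX, II: THE CONNECTIVITIES ACROSS A CUT VERTEX
(p6, gen 45; P6-TWOEXIT-LEAN.md §53 ADDENDUM 16)

RE-ISSUE: this module is the content of `C041TriDomGlueSide` (p709110, ACCEPTED 2026-08-29T08:22Z), whose
post-accept olean build was dropped by the farm (the incident class of INBOX 16449 / 16555 / 16800), re-issued byte
for byte inside the namespace `GlueB` so that the dependent modules can import it; `C041TriDomGlueSide` stays the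
module of record of these statements.

A vertex `v` of the all-free host and a vertex `z ≠ v`; `C = side Z₁ free v z` is the `z`-side of `v` (the vertices
reachable from `z` by edges avoiding `v`, `C041TriDomExcessZeroSide`), `InC v z e` = «the edge `e` touches `C`» — the
edges of the `z`-side.  The two STATUSES `stOut` (the `z`-side deleted) and `stIn` (only the `z`-side kept) and the
decomposition of the all-free connectivities (red `RdS`, blue `MgS`):

* between two vertices off `C` the connectivity is the connectivity of `stOut` (`RdS_free_iff_out`, `MgS_free_iff_out`:
  a walk between them never needs an edge of the `z`-side — it could only enter and leave through `v`);
* between a vertex off `C` and a vertex of `C` it is «to `v` under `stOut`, then from `v` under `stIn`»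
  (`RdS_free_iff_through`, `MgS_free_iff_through`, by `rtg_through` / `rtg_in`);
* the connectivities of `stOut` / `stIn` depend only on the outside / inside part of the colouring
  (`RdS_stOut_merge`, `RdS_stIn_merge`, …), with `merge` / `inN` / `outN` of `C041TriDomGlueMerge` at `In = InC v z`.
-/

namespace PercRepro

namespace ZoneZ

namespace MultiExit

namespace GlueB

open ZoneData Finset

variable {V₁ E₁ U₁ U₂ : Type} (Z₁ : ZoneData V₁ E₁ U₁ U₂) (v z : V₁)

/-! ## The two sides of the cut vertex -/

/-- The edges of the `z`-side of `v`: those touching `side Z₁ free v z`. -/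
def InC : E₁ → Prop := fun e => Z₁.Touches (side Z₁ (fun _ => EStat.free) v z) e

open Classical in
/-- The status with the `z`-side of `v` deleted. -/
noncomputable def stOut : E₁ → EStat := fun e => if InC Z₁ v z e then EStat.absent else EStat.free

open Classical in
/-- The status with only the `z`-side of `v` kept. -/
noncomputable def stIn : E₁ → EStat := fun e => if InC Z₁ v z e then EStat.free else EStat.absent

/-- Every edge is present in the all-free status. -/
theorem presE_free (e : E₁) : presE (fun _ : E₁ => EStat.free) e := fun h => EStat.noConfusion h

/-- Red under the all-free status is «coloured red». -/
theorem redE_free (ω : E₁ → Bool) (e : E₁) : redE (fun _ : E₁ => EStat.free) ω e ↔ ω e = true := by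
  simp [redE]

/-- Blue under the all-free status is «coloured blue». -/
theorem blueE_free (ω : E₁ → Bool) (e : E₁) : blueE (fun _ : E₁ => EStat.free) ω e ↔ ω e = false := by
  simp [blueE]

/-- Red under `stOut`: off the `z`-side and coloured red. -/
theorem redE_stOut (ω : E₁ → Bool) (e : E₁) : redE (stOut Z₁ v z) ω e ↔ ¬ InC Z₁ v z e ∧ ω e = true := by
  unfold redE stOut
  by_cases h : InC Z₁ v z e <;> simp [h]

/-- Blue under `stOut`: off the `z`-side and coloured blue. -/
theorem blueE_stOut (ω : E₁ → Bool) (e : E₁) : blueE (stOut Z₁ v z) ω e ↔ ¬ InC Z₁ v z e ∧ ω e = false := by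
  unfold blueE stOut
  by_cases h : InC Z₁ v z e <;> simp [h]

/-- Red under `stIn`: on the `z`-side and coloured red. -/
theorem redE_stIn (ω : E₁ → Bool) (e : E₁) : redE (stIn Z₁ v z) ω e ↔ InC Z₁ v z e ∧ ω e = true := by
  unfold redE stIn
  by_cases h : InC Z₁ v z e <;> simp [h]

/-- Blue under `stIn`: on the `z`-side and coloured blue. -/
theorem blueE_stIn (ω : E₁ → Bool) (e : E₁) : blueE (stIn Z₁ v z) ω e ↔ InC Z₁ v z e ∧ ω e = false := by
  unfold blueE stIn
  by_cases h : InC Z₁ v z e <;> simp [h]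

/-- The cut vertex is off its own `z`-side. -/
theorem v_not_mem_side (hz : z ≠ v) : v ∉ side Z₁ (fun _ => EStat.free) v z := fun h =>
  ne_of_mem_side Z₁ hz h rfl

/-! ## Walks between vertices off the side avoid the side -/

/-- A walk from `a ∉ C` reaches a vertex `w` off `C` through edges not touching `C`, and a vertex of `C` only after
reaching `v` through edges not touching `C`. -/
theorem rtg_avoid_aux (hz : z ≠ v) {col : E₁ → Prop} {a w : V₁} (ha : a ∉ side Z₁ (fun _ => EStat.free) v z)
    (h : Relation.ReflTransGen (AdjCol Z₁ col) a w) :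
    (w ∉ side Z₁ (fun _ => EStat.free) v z →
        Relation.ReflTransGen (AdjCol Z₁ fun e => col e ∧ ¬ InC Z₁ v z e) a w) ∧
      (w ∈ side Z₁ (fun _ => EStat.free) v z →
        Relation.ReflTransGen (AdjCol Z₁ fun e => col e ∧ ¬ InC Z₁ v z e) a v) := by
  induction h with
  | refl => exact ⟨fun _ => Relation.ReflTransGen.refl, fun h => absurd h ha⟩
  | @tail w w' _ hww' ih =>
    obtain ⟨e, hj, hce⟩ := hww'
    constructor
    · intro hw'
      by_cases hw : w ∈ side Z₁ (fun _ => EStat.free) v z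
      · obtain rfl : w' = v := by
          by_contra hne
          exact hw' (side_closed Z₁ hz hw (presE_free e) hj hne)
        exact ih.2 hw
      · refine (ih.1 hw).tail ⟨e, hj, hce, ?_⟩
        unfold InC
        rw [touches_iff_of_joins Z₁ _ hj]
        rintro (h | h)
        · exact hw h
        · exact hw' h
    · intro hw'
      by_cases hw : w ∈ side Z₁ (fun _ => EStat.free) v z
      · exact ih.2 hw
      · obtain rfl : w = v := by
          by_contra hne
          exact hw (side_closed Z₁ hz hw' (presE_free e) (Joins_symm Z₁ hj) hne)
        exact ih.1 hw

/-- A walk between two vertices off the `z`-side of `v` can avoid the edges of that side. -/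
theorem rtg_avoid (hz : z ≠ v) {col : E₁ → Prop} {a b : V₁} (ha : a ∉ side Z₁ (fun _ => EStat.free) v z)
    (hb : b ∉ side Z₁ (fun _ => EStat.free) v z) (h : Relation.ReflTransGen (AdjCol Z₁ col) a b) :
    Relation.ReflTransGen (AdjCol Z₁ fun e => col e ∧ ¬ InC Z₁ v z e) a b :=
  (rtg_avoid_aux Z₁ v z hz ha h).1 hb

/-! ## The decomposition of the all-free connectivities -/

/-- Red connectivity between two vertices off the `z`-side is red connectivity with that side deleted. -/
theorem RdS_free_iff_out (hz : z ≠ v) (ω : E₁ → Bool) {a b : V₁} (ha : a ∉ side Z₁ (fun _ => EStat.free) v z)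
    (hb : b ∉ side Z₁ (fun _ => EStat.free) v z) :
    RdS Z₁ (fun _ => EStat.free) ω a b ↔ RdS Z₁ (stOut Z₁ v z) ω a b := by
  unfold RdS
  rw [mem_reach_singleton, mem_reach_singleton, RAdjS_eq_AdjCol, RAdjS_eq_AdjCol]
  constructor
  · intro h
    refine Relation.ReflTransGen.mono (fun x y hxy => ?_) _ _ (rtg_avoid Z₁ v z hz ha hb h)
    obtain ⟨e, hj, hc, hn⟩ := hxy
    exact ⟨e, hj, (redE_stOut Z₁ v z ω e).mpr ⟨hn, (redE_free ω e).mp hc⟩⟩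
  · intro h
    refine Relation.ReflTransGen.mono (fun x y hxy => ?_) _ _ h
    obtain ⟨e, hj, hc⟩ := hxy
    exact ⟨e, hj, (redE_free ω e).mpr ((redE_stOut Z₁ v z ω e).mp hc).2⟩

/-- Blue connectivity between two vertices off the `z`-side is blue connectivity with that side deleted. -/
theorem MgS_free_iff_out (hz : z ≠ v) (ω : E₁ → Bool) {a b : V₁} (ha : a ∉ side Z₁ (fun _ => EStat.free) v z)
    (hb : b ∉ side Z₁ (fun _ => EStat.free) v z) :
    MgS Z₁ (fun _ => EStat.free) ω a b ↔ MgS Z₁ (stOut Z₁ v z) ω a b := by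
  unfold MgS
  rw [mem_reach_singleton, mem_reach_singleton, BAdjS_eq_AdjCol, BAdjS_eq_AdjCol]
  constructor
  · intro h
    refine Relation.ReflTransGen.mono (fun x y hxy => ?_) _ _ (rtg_avoid Z₁ v z hz ha hb h)
    obtain ⟨e, hj, hc, hn⟩ := hxy
    exact ⟨e, hj, (blueE_stOut Z₁ v z ω e).mpr ⟨hn, (blueE_free ω e).mp hc⟩⟩
  · intro h
    refine Relation.ReflTransGen.mono (fun x y hxy => ?_) _ _ h
    obtain ⟨e, hj, hc⟩ := hxy
    exact ⟨e, hj, (blueE_free ω e).mpr ((blueE_stOut Z₁ v z ω e).mp hc).2⟩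

/-- A walk from `v` into the `z`-side lives on its edges: connectivity under `stIn`. -/
theorem rtg_into_side (hz : z ≠ v) {col : E₁ → Prop} {c : V₁} (hc : c ∈ side Z₁ (fun _ => EStat.free) v z)
    (h : Relation.ReflTransGen (AdjCol Z₁ col) v c) :
    Relation.ReflTransGen (AdjCol Z₁ fun e => col e ∧ InC Z₁ v z e) v c := by
  have h' := rtg_in Z₁ hz (fun e _ => presE_free e) h hc
  refine Relation.ReflTransGen.mono (fun x y hxy => ?_) _ _ h'
  obtain ⟨e, hj, hce, ht⟩ := hxy
  exact ⟨e, hj, hce, ht⟩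

/-- Red connectivity from a vertex off the `z`-side to a vertex of it passes through `v`: to `v` with the side
deleted, then from `v` inside the side. -/
theorem RdS_free_iff_through (hz : z ≠ v) (ω : E₁ → Bool) {a c : V₁}
    (ha : a ∉ side Z₁ (fun _ => EStat.free) v z) (hc : c ∈ side Z₁ (fun _ => EStat.free) v z) :
    RdS Z₁ (fun _ => EStat.free) ω a c ↔ RdS Z₁ (stOut Z₁ v z) ω a v ∧ RdS Z₁ (stIn Z₁ v z) ω v c := by
  have hv := v_not_mem_side Z₁ v z hz
  constructor
  · intro h
    have h' := h
    unfold RdS at h'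
    rw [mem_reach_singleton, RAdjS_eq_AdjCol] at h'
    obtain ⟨h1, h2⟩ := rtg_through Z₁ hz (fun e _ => presE_free e) ha h' hc
    refine ⟨?_, ?_⟩
    · rw [← RdS_free_iff_out Z₁ v z hz ω ha hv]
      unfold RdS
      rw [mem_reach_singleton, RAdjS_eq_AdjCol]
      exact h1
    · unfold RdS
      rw [mem_reach_singleton, RAdjS_eq_AdjCol]
      refine Relation.ReflTransGen.mono (fun x y hxy => ?_) _ _ (rtg_into_side Z₁ v z hz hc h2)
      obtain ⟨e, hj, hce, hi⟩ := hxy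
      exact ⟨e, hj, (redE_stIn Z₁ v z ω e).mpr ⟨hi, (redE_free ω e).mp hce⟩⟩
  · rintro ⟨h1, h2⟩
    rw [← RdS_free_iff_out Z₁ v z hz ω ha hv] at h1
    refine reach_trans' h1 ?_
    unfold RdS at h2
    rw [mem_reach_singleton, RAdjS_eq_AdjCol] at h2 ⊢
    refine Relation.ReflTransGen.mono (fun x y hxy => ?_) _ _ h2
    obtain ⟨e, hj, hce⟩ := hxy
    exact ⟨e, hj, (redE_free ω e).mpr ((redE_stIn Z₁ v z ω e).mp hce).2⟩

/-- Blue connectivity from a vertex off the `z`-side to a vertex of it passes through `v`. -/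
theorem MgS_free_iff_through (hz : z ≠ v) (ω : E₁ → Bool) {a c : V₁}
    (ha : a ∉ side Z₁ (fun _ => EStat.free) v z) (hc : c ∈ side Z₁ (fun _ => EStat.free) v z) :
    MgS Z₁ (fun _ => EStat.free) ω a c ↔ MgS Z₁ (stOut Z₁ v z) ω a v ∧ MgS Z₁ (stIn Z₁ v z) ω v c := by
  have hv := v_not_mem_side Z₁ v z hz
  constructor
  · intro h
    have h' := h
    unfold MgS at h'
    rw [mem_reach_singleton, BAdjS_eq_AdjCol] at h'
    obtain ⟨h1, h2⟩ := rtg_through Z₁ hz (fun e _ => presE_free e) ha h' hc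
    refine ⟨?_, ?_⟩
    · rw [← MgS_free_iff_out Z₁ v z hz ω ha hv]
      unfold MgS
      rw [mem_reach_singleton, BAdjS_eq_AdjCol]
      exact h1
    · unfold MgS
      rw [mem_reach_singleton, BAdjS_eq_AdjCol]
      refine Relation.ReflTransGen.mono (fun x y hxy => ?_) _ _ (rtg_into_side Z₁ v z hz hc h2)
      obtain ⟨e, hj, hce, hi⟩ := hxy
      exact ⟨e, hj, (blueE_stIn Z₁ v z ω e).mpr ⟨hi, (blueE_free ω e).mp hce⟩⟩
  · rintro ⟨h1, h2⟩
    rw [← MgS_free_iff_out Z₁ v z hz ω ha hv] at h1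
    refine reach_trans' h1 ?_
    unfold MgS at h2
    rw [mem_reach_singleton, BAdjS_eq_AdjCol] at h2 ⊢
    refine Relation.ReflTransGen.mono (fun x y hxy => ?_) _ _ h2
    obtain ⟨e, hj, hce⟩ := hxy
    exact ⟨e, hj, (blueE_free ω e).mpr ((blueE_stIn Z₁ v z ω e).mp hce).2⟩

/-! ## The connectivities of the two statuses see one side only -/

section Merge

open Classical in
/-- Red connectivity under `stOut` depends only on the outside part. -/
theorem RdS_stOut_merge (o i : E₁ → Bool) (a b : V₁) :
    RdS Z₁ (stOut Z₁ v z) (merge (InC Z₁ v z) o i) a b ↔ RdS Z₁ (stOut Z₁ v z) o a b := by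
  unfold RdS
  rw [RAdjS_congr Z₁ (st' := stOut Z₁ v z) (ω' := o) fun e => ?_]
  rw [redE_stOut, redE_stOut]
  constructor
  · rintro ⟨hn, he⟩
    exact ⟨hn, by rwa [merge_of_not_in _ _ _ hn] at he⟩
  · rintro ⟨hn, he⟩
    exact ⟨hn, by rwa [merge_of_not_in _ _ _ hn]⟩

open Classical in
/-- Blue connectivity under `stOut` depends only on the outside part. -/
theorem MgS_stOut_merge (o i : E₁ → Bool) (a b : V₁) :
    MgS Z₁ (stOut Z₁ v z) (merge (InC Z₁ v z) o i) a b ↔ MgS Z₁ (stOut Z₁ v z) o a b := by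
  unfold MgS
  rw [BAdjS_congr Z₁ (st' := stOut Z₁ v z) (ω' := o) fun e => ?_]
  rw [blueE_stOut, blueE_stOut]
  constructor
  · rintro ⟨hn, he⟩
    exact ⟨hn, by rwa [merge_of_not_in _ _ _ hn] at he⟩
  · rintro ⟨hn, he⟩
    exact ⟨hn, by rwa [merge_of_not_in _ _ _ hn]⟩

open Classical in
/-- Red connectivity under `stIn` depends only on the inside part. -/
theorem RdS_stIn_merge (o i : E₁ → Bool) (a b : V₁) :
    RdS Z₁ (stIn Z₁ v z) (merge (InC Z₁ v z) o i) a b ↔ RdS Z₁ (stIn Z₁ v z) i a b := by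
  unfold RdS
  rw [RAdjS_congr Z₁ (st' := stIn Z₁ v z) (ω' := i) fun e => ?_]
  rw [redE_stIn, redE_stIn]
  constructor
  · rintro ⟨hn, he⟩
    exact ⟨hn, by rwa [merge_of_in _ _ _ hn] at he⟩
  · rintro ⟨hn, he⟩
    exact ⟨hn, by rwa [merge_of_in _ _ _ hn]⟩

open Classical in
/-- Blue connectivity under `stIn` depends only on the inside part. -/
theorem MgS_stIn_merge (o i : E₁ → Bool) (a b : V₁) :
    MgS Z₁ (stIn Z₁ v z) (merge (InC Z₁ v z) o i) a b ↔ MgS Z₁ (stIn Z₁ v z) i a b := by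
  unfold MgS
  rw [BAdjS_congr Z₁ (st' := stIn Z₁ v z) (ω' := i) fun e => ?_]
  rw [blueE_stIn, blueE_stIn]
  constructor
  · rintro ⟨hn, he⟩
    exact ⟨hn, by rwa [merge_of_in _ _ _ hn] at he⟩
  · rintro ⟨hn, he⟩
    exact ⟨hn, by rwa [merge_of_in _ _ _ hn]⟩

open Classical in
/-- Red connectivity under `stOut` depends only on the outside part (normalised form). -/
theorem RdS_stOut_outN (ω : E₁ → Bool) (a b : V₁) :
    RdS Z₁ (stOut Z₁ v z) ω a b ↔ RdS Z₁ (stOut Z₁ v z) (outN (InC Z₁ v z) ω) a b := by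
  conv_lhs => rw [← merge_outN_inN (InC Z₁ v z) ω]
  exact RdS_stOut_merge Z₁ v z _ _ a b

open Classical in
/-- Blue connectivity under `stOut` depends only on the outside part (normalised form). -/
theorem MgS_stOut_outN (ω : E₁ → Bool) (a b : V₁) :
    MgS Z₁ (stOut Z₁ v z) ω a b ↔ MgS Z₁ (stOut Z₁ v z) (outN (InC Z₁ v z) ω) a b := by
  conv_lhs => rw [← merge_outN_inN (InC Z₁ v z) ω]
  exact MgS_stOut_merge Z₁ v z _ _ a b

open Classical in
/-- Red connectivity under `stIn` depends only on the inside part (normalised form). -/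
theorem RdS_stIn_inN (ω : E₁ → Bool) (a b : V₁) :
    RdS Z₁ (stIn Z₁ v z) ω a b ↔ RdS Z₁ (stIn Z₁ v z) (inN (InC Z₁ v z) ω) a b := by
  conv_lhs => rw [← merge_outN_inN (InC Z₁ v z) ω]
  exact RdS_stIn_merge Z₁ v z _ _ a b

open Classical in
/-- Blue connectivity under `stIn` depends only on the inside part (normalised form). -/
theorem MgS_stIn_inN (ω : E₁ → Bool) (a b : V₁) :
    MgS Z₁ (stIn Z₁ v z) ω a b ↔ MgS Z₁ (stIn Z₁ v z) (inN (InC Z₁ v z) ω) a b := by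
  conv_lhs => rw [← merge_outN_inN (InC Z₁ v z) ω]
  exact MgS_stIn_merge Z₁ v z _ _ a b

end Merge

end GlueB

end MultiExit

end ZoneZ

end PercRepro
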